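import Summits.QuantumAdvantage.QuantumAdvantage.Theorems.SosSandwichPseudoBoundedAAClassicalCornerPathSensitivityLeaf
import HarnessLib

/-!
# Crux `PseudoBoundedAA` (stmt-QuantumAdvantage-15237, route SosSandwich) — the classical corner `R_T`:
# the PATH-SENSITIVITY LAW `16 · Var[p]² ≤ Σ_k w_k · E_x Σ_{l ∈ t_k.queries x} (p(x^{l→1}) − p(x^{l→0}))²`

Support file for the rank-2 crux PB-AA (`Theses/SosSandwich.lean`, item stmt-QuantumAdvantage-15237), classical corner
`R_T ⊆ K_T` (acceptance probabilities `p = Σ_k w_k·[t_k accepts]` of randomized classical query algorithms).  The tree holds on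
`R_T` the laws `16·Var[p]² ≤ D̄²·maxⱼ Infⱼ[p]` (`ClassicalCorner`), `16·Var² ≤ D̄·E_x maxⱼ (p(x) − p(xʲ))²`
(`ClassicalCornerQuadratic`) and its expected-cost form (`ClassicalCornerQuadraticCost`); whether `16·Var² ≤ C·T·maxⱼ Infⱼ`
(exponent ONE in `T` with the maximum OUTSIDE the expectation) holds on `R_T` is the open calibration question, settled for the
nonadaptive sub-corner and for the level-one part of the variance in the companion files `…ClassicalCornerNonadaptive`,
`…ClassicalCornerLevelOne`.

This file proves the sharpest law of this family, charging the squared increments of `p` ONLY at the coordinates the tree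
actually reads on each input (`DecisionTree.queries`, `Literature/Computability/Complexity/DecisionTreeQueries`):

  `16 · Var[p]² ≤ Σ_k w_k · E_x Σ_{l ∈ t_k.queries x} (p(x^{l→1}) − p(x^{l→0}))²`   (`sixteen_variance_sq_le_pathSensitivity`),

equality shape for the uniform mixture of the `N` dictators.  Since `Σ_{l ∈ queries x} (…)² ≤ cost_{t}(x) · maxⱼ (…)²`
(`pathSensitivity_le_cost_mul`) it refines the earlier laws, and it reduces the `(2,1)` question on `R_T` to ONE inequality
(`sixteen_variance_sq_le_of_pathSensitivity_le`): is the sensitivity that `p ∈ R_T` carries along the query path of a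
depth-`T` tree of its own mixture at most `C · T · maxⱼ Infⱼ[p]`?

* (per tree, file `…PathSensitivityLeaf`: `exists_leafAvg_path`, `cov_le_sqrt_pathSensitivity[_self]`, `pathSensitivity_le_cost_mul`);
* `sixteen_variance_sq_le_weighted` (general weights), **`sixteen_variance_sq_le_pathSensitivity`** (`Σ w ≤ 1`),
  `sixteen_variance_sq_le_of_pathSensitivity_le` (the reduction to ONE inequality).

Honest label: a sharpened form (same inductive proof, finer bookkeeping) of the tree's quadratic OSSS law on the classical
corner of an open conjecture; no stub, crux or summit is closed.
Sources: R. O'Donnell, M. Saks, O. Schramm, R. Servedio, *Every decision tree has an influential variable*, FOCS 2005, Thm 3.2;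
H. Lee, *Decision trees and influence: an inductive proof of the OSSS inequality*, Theory of Computing 6 (2010) 81–84;
S. Aaronson, A. Ambainis, *The need for structure in quantum speedups*, arXiv:0911.0996, Conj. 6 / Thm 8.
-/

set_option linter.dupNamespace false

noncomputable section

namespace Summit.QuantumAdvantage.QuantumAdvantage.Theorems.SosSandwich

open Finset Function
open Literature.Computability.Complexity Literature.Computability.QuantumComplexity

namespace ClassicalCornerPathSensitivity

variable {N : ℕ}

/-! ### Mixtures: the path-sensitivity law -/

/-- **Path-sensitivity law for MIXTURES of decision trees, general weights.**  If the real polynomial `p` takes on the cube the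
values `Σ_{k∈s} w_k·[t_k accepts x]` (`w_k ≥ 0`, `W = Σ_k w_k`), then

  `16 · Var[p]² ≤ W · Σ_k w_k · E_x Σ_{l ∈ t_k.queries x} (p(x^{l→1}) − p(x^{l→0}))²`.

The squared increments of `p` are charged ONLY at the coordinates that the tree `t_k` reads on `x` (the tree's earlier
laws charge `depth(t_k) · maxⱼ E(p − pʲ)²`, `ClassicalCorner`, or `cost_{t_k}(x) · maxⱼ (p(x) − p(xʲ))²`,
`ClassicalCornerQuadraticCost`; since `Σ_{l ∈ queries} (…)² ≤ #queries · maxⱼ (…)²`, this statement refines both).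
Proof: `Var[p] = Σ_k w_k Cov([t_k accepts], p)`, `cov_le_sqrt_pathSensitivity_self`, weighted Cauchy–Schwarz.
[cite: OdonnellEtAl2005, Thm 3.2 (L¹ form)] [cite: AaronsonAmbainis2014, Thm 8 and the remark following it] -/
theorem sixteen_variance_sq_le_weighted {ι : Type*} (s : Finset ι) (w : ι → ℝ) (hw : ∀ k ∈ s, 0 ≤ w k)
    (t : ι → DecisionTree N) (p : MvPolynomial (Fin N) ℝ)
    (hp : ∀ x, evalBool p x = ∑ k ∈ s, w k * (if (t k).eval x = true then (1 : ℝ) else 0)) :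
    16 * boolVariance p ^ 2 ≤
      (∑ k ∈ s, w k) * ∑ k ∈ s, w k * ((∑ x : Fin N → Bool, ∑ l ∈ (t k).queries x,
        (evalBool p (update x l true) - evalBool p (update x l false)) ^ 2) / (2 : ℝ) ^ N) := by
  obtain ⟨F, hF⟩ : ∃ F : ι → (Fin N → Bool) → ℝ, ∀ k x, F k x = if (t k).eval x = true then (1 : ℝ) else 0 :=
    ⟨_, fun _ _ => rfl⟩
  have h2N : (0 : ℝ) < (2 : ℝ) ^ N := by positivity
  have hp' : ∀ x, evalBool p x = ∑ k ∈ s, w k * F k x := fun x => by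
    rw [hp x]; exact Finset.sum_congr rfl fun k _ => by rw [hF k x]
  -- linearity of the covariance in the first argument
  have hPg : ∑ x, evalBool p x * evalBool p x = ∑ k ∈ s, w k * ∑ x, F k x * evalBool p x := by
    calc ∑ x, evalBool p x * evalBool p x = ∑ x, ∑ k ∈ s, w k * (F k x * evalBool p x) := by
          refine Finset.sum_congr rfl fun x _ => ?_
          nth_rw 1 [hp' x]
          rw [Finset.sum_mul]
          exact Finset.sum_congr rfl fun k _ => by ring
      _ = ∑ k ∈ s, ∑ x, w k * (F k x * evalBool p x) := Finset.sum_comm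
      _ = ∑ k ∈ s, w k * ∑ x, F k x * evalBool p x :=
          Finset.sum_congr rfl fun k _ => by rw [Finset.mul_sum]
  have hPs : ∑ x, evalBool p x = ∑ k ∈ s, w k * ∑ x, F k x := by
    calc ∑ x, evalBool p x = ∑ x, ∑ k ∈ s, w k * F k x := Finset.sum_congr rfl fun x _ => by rw [hp' x]
      _ = ∑ k ∈ s, ∑ x, w k * F k x := Finset.sum_comm
      _ = ∑ k ∈ s, w k * ∑ x, F k x := Finset.sum_congr rfl fun k _ => by rw [Finset.mul_sum]
  have hlin : (2 : ℝ) ^ N * (∑ x, evalBool p x * evalBool p x) - (∑ x, evalBool p x) * (∑ x, evalBool p x)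
      = ∑ k ∈ s, w k * ((2 : ℝ) ^ N * (∑ x, F k x * evalBool p x) - (∑ x, F k x) * (∑ x, evalBool p x)) := by
    have e1 : (2 : ℝ) ^ N * (∑ x, evalBool p x * evalBool p x)
        = ∑ k ∈ s, w k * ((2 : ℝ) ^ N * ∑ x, F k x * evalBool p x) := by
      rw [hPg, Finset.mul_sum]
      exact Finset.sum_congr rfl fun k _ => by ring
    have e2 : (∑ x, evalBool p x) * (∑ x, evalBool p x)
        = ∑ k ∈ s, w k * ((∑ x, F k x) * ∑ x, evalBool p x) := by
      nth_rw 1 [hPs]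
      rw [Finset.sum_mul]
      exact Finset.sum_congr rfl fun k _ => by ring
    rw [e1, e2, ← Finset.sum_sub_distrib]
    exact Finset.sum_congr rfl fun k _ => by ring
  -- each tree: `cov_le_sqrt_pathSensitivity_self`
  obtain ⟨S, hS⟩ : ∃ S : ι → ℝ, ∀ k, S k = (2 : ℝ) ^ N * ∑ x : Fin N → Bool, ∑ l ∈ (t k).queries x,
      (evalBool p (update x l true) - evalBool p (update x l false)) ^ 2 := ⟨_, fun _ => rfl⟩
  have hS0 : ∀ k ∈ s, 0 ≤ S k := fun k _ => by
    rw [hS]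
    exact mul_nonneg h2N.le (Finset.sum_nonneg fun x _ => Finset.sum_nonneg fun l _ => sq_nonneg _)
  have hterm : ∀ k ∈ s, w k * ((2 : ℝ) ^ N * (∑ x, F k x * evalBool p x) - (∑ x, F k x) * (∑ x, evalBool p x))
      ≤ w k * ((2 : ℝ) ^ N / 4 * Real.sqrt (S k)) := fun k hk => by
    rw [hS]
    exact mul_le_mul_of_nonneg_left (cov_le_sqrt_pathSensitivity_self (t k) (F k) (evalBool p) (hF k)) (hw k hk)
  have hsum : (2 : ℝ) ^ N * (∑ x, evalBool p x * evalBool p x) - (∑ x, evalBool p x) * (∑ x, evalBool p x)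
      ≤ (2 : ℝ) ^ N / 4 * ∑ k ∈ s, w k * Real.sqrt (S k) := by
    rw [hlin, Finset.mul_sum]
    refine Finset.sum_le_sum fun k hk => (hterm k hk).trans_eq ?_
    ring
  -- weighted Cauchy–Schwarz over the mixture
  have hcs := ClassicalCornerQuadratic.sum_mul_sqrt_le s w S hw hS0
  have hvar : (2 : ℝ) ^ N * (∑ x, evalBool p x * evalBool p x) - (∑ x, evalBool p x) * (∑ x, evalBool p x)
      = (2 : ℝ) ^ N * ((2 : ℝ) ^ N * boolVariance p) :=
    BooleanCorner.sum_sq_sub_sq_sum_eq p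
  set W := ∑ k ∈ s, w k with hW
  set Q := ∑ k ∈ s, w k * S k with hQ
  have hW0 : 0 ≤ W := Finset.sum_nonneg hw
  have hQ0 : 0 ≤ Q := Finset.sum_nonneg fun k hk => mul_nonneg (hw k hk) (hS0 k hk)
  have hV0 : 0 ≤ boolVariance p := boolVariance_nonneg p
  have h := (hvar.symm.le.trans hsum).trans (mul_le_mul_of_nonneg_left hcs (by positivity))
  have hmain : 4 * ((2 : ℝ) ^ N * boolVariance p) ≤ Real.sqrt W * Real.sqrt Q := by
    have h' : (2 : ℝ) ^ N * (4 * ((2 : ℝ) ^ N * boolVariance p)) ≤ (2 : ℝ) ^ N * (Real.sqrt W * Real.sqrt Q) :=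
      calc (2 : ℝ) ^ N * (4 * ((2 : ℝ) ^ N * boolVariance p)) = 4 * ((2 : ℝ) ^ N * ((2 : ℝ) ^ N * boolVariance p)) := by
            ring
        _ ≤ 4 * ((2 : ℝ) ^ N / 4 * (Real.sqrt W * Real.sqrt Q)) := mul_le_mul_of_nonneg_left h (by norm_num)
        _ = (2 : ℝ) ^ N * (Real.sqrt W * Real.sqrt Q) := by ring
    exact le_of_mul_le_mul_left h' h2N
  have hsq : (4 * ((2 : ℝ) ^ N * boolVariance p)) ^ 2 ≤ W * Q := by
    have h1 := pow_le_pow_left₀ (by positivity) hmain 2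
    have hR : (Real.sqrt W * Real.sqrt Q) ^ 2 = W * Q := by
      rw [mul_pow, Real.sq_sqrt hW0, Real.sq_sqrt hQ0]
    rwa [hR] at h1
  -- `Q = 2^N · Σ_k w_k P_k`
  have hQ' : Q = (2 : ℝ) ^ N * ∑ k ∈ s, w k * (∑ x : Fin N → Bool, ∑ l ∈ (t k).queries x,
      (evalBool p (update x l true) - evalBool p (update x l false)) ^ 2) := by
    rw [hQ, Finset.mul_sum]
    exact Finset.sum_congr rfl fun k _ => by rw [hS]; ring
  have hfin : (16 * boolVariance p ^ 2 * (2 : ℝ) ^ N) * (2 : ℝ) ^ N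
      ≤ (W * ∑ k ∈ s, w k * (∑ x : Fin N → Bool, ∑ l ∈ (t k).queries x,
          (evalBool p (update x l true) - evalBool p (update x l false)) ^ 2)) * (2 : ℝ) ^ N :=
    calc (16 * boolVariance p ^ 2 * (2 : ℝ) ^ N) * (2 : ℝ) ^ N = (4 * ((2 : ℝ) ^ N * boolVariance p)) ^ 2 := by ring
      _ ≤ W * Q := hsq
      _ = _ := by rw [hQ']; ring
  have hfin' := le_of_mul_le_mul_right hfin h2N
  have hresc : W * ∑ k ∈ s, w k * ((∑ x : Fin N → Bool, ∑ l ∈ (t k).queries x,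
        (evalBool p (update x l true) - evalBool p (update x l false)) ^ 2) / (2 : ℝ) ^ N)
      = (W * ∑ k ∈ s, w k * (∑ x : Fin N → Bool, ∑ l ∈ (t k).queries x,
          (evalBool p (update x l true) - evalBool p (update x l false)) ^ 2)) / (2 : ℝ) ^ N := by
    rw [mul_div_assoc, Finset.sum_div]
    congr 1
    exact Finset.sum_congr rfl fun k _ => by ring
  rw [hresc, le_div_iff₀ h2N]
  exact hfin'

/-- **THE PATH-SENSITIVITY LAW on the classical corner.**  If `p` is on the cube the acceptance probability of a randomized
classical query algorithm (`p = Σ_k w_k·[t_k accepts]`, `w_k ≥ 0`, `Σ_k w_k ≤ 1`), then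

  `16 · Var[p]² ≤ Σ_k w_k · E_x Σ_{l ∈ t_k.queries x} (p(x^{l→1}) − p(x^{l→0}))²`:

the variance is controlled by the sensitivity that `p` carries ALONG THE QUERY PATHS of its own trees.  Equality shape for the
uniform mixture of the `N` dictators (`T = 1`).  The open `(2,1)`-calibration question for `R_T` (is `16·Var² ≤ C·T·maxⱼ Infⱼ`?)
is thereby reduced to bounding the right-hand side by `C · T · maxⱼ Infⱼ[p]` (`sixteen_variance_sq_le_of_pathSensitivity_le`).
[cite: OdonnellEtAl2005, Thm 3.2 (L¹ form)] [cite: AaronsonAmbainis2014, Conj. 6 / Thm 8] -/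
theorem sixteen_variance_sq_le_pathSensitivity {ι : Type*} (s : Finset ι) (w : ι → ℝ) (hw : ∀ k ∈ s, 0 ≤ w k)
    (hw1 : ∑ k ∈ s, w k ≤ 1) (t : ι → DecisionTree N) (p : MvPolynomial (Fin N) ℝ)
    (hp : ∀ x, evalBool p x = ∑ k ∈ s, w k * (if (t k).eval x = true then (1 : ℝ) else 0)) :
    16 * boolVariance p ^ 2 ≤
      ∑ k ∈ s, w k * ((∑ x : Fin N → Bool, ∑ l ∈ (t k).queries x,
        (evalBool p (update x l true) - evalBool p (update x l false)) ^ 2) / (2 : ℝ) ^ N) := by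
  have h := sixteen_variance_sq_le_weighted s w hw t p hp
  have hX0 : 0 ≤ ∑ k ∈ s, w k * ((∑ x : Fin N → Bool, ∑ l ∈ (t k).queries x,
      (evalBool p (update x l true) - evalBool p (update x l false)) ^ 2) / (2 : ℝ) ^ N) :=
    Finset.sum_nonneg fun k hk => mul_nonneg (hw k hk)
      (div_nonneg (Finset.sum_nonneg fun x _ => Finset.sum_nonneg fun l _ => sq_nonneg _) (by positivity))
  calc 16 * boolVariance p ^ 2 ≤ _ := h
    _ ≤ 1 * _ := mul_le_mul_of_nonneg_right hw1 hX0
    _ = _ := one_mul _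

/-- **The reduction in kernel form.** If every tree of the mixture has expected path sensitivity
`E_x Σ_{l ∈ t_k.queries x} (p(x^{l→1}) − p(x^{l→0}))² ≤ K`, then `16 · Var[p]² ≤ K`.  With `K = C·T·maxⱼ Infⱼ[p]` this is the
`(2,1)` law on `R_T`; the hypothesis in that form ("the sensitivity of `p` along the query path of a depth-`T` tree of its own
mixture is at most `C·T` times its largest influence") is what remains to be proved or refuted.
[cite: OdonnellEtAl2005, Thm 3.2 (L¹ form)] [cite: AaronsonAmbainis2014, Conj. 6 / Thm 8] -/
theorem sixteen_variance_sq_le_of_pathSensitivity_le {ι : Type*} (s : Finset ι) (w : ι → ℝ) (hw : ∀ k ∈ s, 0 ≤ w k)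
    (hw1 : ∑ k ∈ s, w k ≤ 1) (t : ι → DecisionTree N) (p : MvPolynomial (Fin N) ℝ)
    (hp : ∀ x, evalBool p x = ∑ k ∈ s, w k * (if (t k).eval x = true then (1 : ℝ) else 0))
    (K : ℝ) (hK0 : 0 ≤ K)
    (hK : ∀ k ∈ s, (∑ x : Fin N → Bool, ∑ l ∈ (t k).queries x,
        (evalBool p (update x l true) - evalBool p (update x l false)) ^ 2) / (2 : ℝ) ^ N ≤ K) :
    16 * boolVariance p ^ 2 ≤ K := by
  refine (sixteen_variance_sq_le_pathSensitivity s w hw hw1 t p hp).trans ?_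
  calc ∑ k ∈ s, w k * ((∑ x : Fin N → Bool, ∑ l ∈ (t k).queries x,
          (evalBool p (update x l true) - evalBool p (update x l false)) ^ 2) / (2 : ℝ) ^ N)
      ≤ ∑ k ∈ s, w k * K := Finset.sum_le_sum fun k hk => mul_le_mul_of_nonneg_left (hK k hk) (hw k hk)
    _ = (∑ k ∈ s, w k) * K := by rw [Finset.sum_mul]
    _ ≤ 1 * K := mul_le_mul_of_nonneg_right hw1 hK0
    _ = K := one_mul _

end ClassicalCornerPathSensitivity

end Summit.QuantumAdvantage.QuantumAdvantage.Theorems.SosSandwich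

end
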